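import Mathlib
import HarnessLib
import Summits.HubbardSuperconductivity.HubbardSuperconductivity.Theorems.KLProgrammeKLRegimeEngineTowerImportP2Plain
import Summits.HubbardSuperconductivity.HubbardSuperconductivity.Theorems.KLProgrammeKLRegimeEngineThinCount6Doors

/-!
# Route `KLProgramme` — crux K3 ENGINE (stmt-HubbardSuperconductivity-20437 `KLRegimeEngineV17F2`), stub (b) v2 (ℓ), import `X` (six legs, one level) IN FLOOR UNITS
# FROM THE PLAIN SIX-LEG LINE: the aniso-from-plain transfer at ANY leg count, and the composed six-leg consumer («(ℓ)-IMPORT-X-FLOOR» ∘ «X-PLAIN-LINE»;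
# cell gate-hubbard-kl, seat hubbard-kl-k3c2-p3 g15, pen (R324)(C)(ii))

`…ThinCount6Doors.klTowerMuLevAtF_zero_three_le_floor_import_doors` (p689804) reads the six-leg one-level floor array of block `k` from the five-anchored count modulo the
all-fixed anisotropic SIX-leg pinned line `B₆` (any leg pinned anywhere).  `…AnisoLineFromPlain` (p586153) turned a PLAIN pinned `L¹` line into the anisotropic all-fixed
line at FOUR legs (`CA⁴·S`); its tool `fixedTupleL1_le_of_plateau_transfer` (p583258) is generic in the leg count, and so is the translation-invariance glue
`sum_filter_leg_eq_sum_pinned` (p586655).  This file records the generic-leg versions and composes them at six legs, exactly as `…TowerImportP2FloorPlain` (p690069) did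
at four:

* §1 **`fixedTupleL1_klAniso_le_of_plain_of_thresholds_legs`** / **`fixedTupleL1_klAniso_le_of_plain_klEng_legs`** — `∃ CA > 0`, ONE absolute constant for EVERY leg
  count: in the regime (absolute thresholds, resp. exactly the binders of `stub_engine_step_norms`), for every `m`, `G`, `1 ≤ n ≤ nScales β + 1`, label string `ω` and
  spin/charge strings: plain `(m+1)`-leg pinned `L¹ ≤ S` at every pin ⇒ `fixedTupleL1 β m (W^{F_n}_{m+1}(G)) ((ω i, s i), c i) x₁ ≤ CA^{m+1}·S`
  (p586153's §3 is the instance `m = 3`, with the same `CA`);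
* §2 **`pinnedSum_le_of_fixedTupleL1_le_legs`** — leg-`0` line ⇒ any-leg line for `W^F_{m+1}(𝒱_j[K])` at any `m` (translation invariance);
* §3 **`klTowerMuLevAtF_zero_three_le_floor_import_of_plainLine_klEng`** — `∃ CA > 0`: under the stub binders (`P.WF`, `R.WF2`, `c ≤ klEngC₃6`, `U ≤ klEngU₀9`,
  `klEngL₃`, `klEngM₃`, `FrameOK`) and the six-count doors (`c ≤ klThinCount6C₃ R`, `U ≤ klThinCount6U₀ R`), for every block with `1 ≤ dk − 1 ≤ nScales β + 1` and
  every plain SIX-leg line `S₆ ≥ 0` of `𝒱_{dk}[K]`:  `klTowerMuLevAtF L M β U μ K d 0 k 3 ≤ 110592·klThinCount6C·(CA⁶·S₆)/ε⁵` — the `X` row of the F-law (and RO-5's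
  `hsix` class) on the producer target `S₆` (E1's plain six-leg line) instead of the all-fixed `B₆`.
Proofs only (compositions of landed theorems); nothing about the model is asserted; nothing asserts (ℓ), any stub, K3 or superconductivity.
References: BGM 2006 §2.7 (2.70)–(2.71a), §2.8 (2.76)–(2.77), (2.96)–(2.98), Lemma 2.5 [cite: BenfattoGiulianiMastropietro2006].
-/

noncomputable section

namespace Summit.HubbardSuperconductivity.HubbardSuperconductivity.Theorems.EngineV8

set_option linter.dupNamespace false -- summit = problem name (single-conjunct summit), D-0017

open Classical
open Real Finset Complex Literature.MathematicalPhysics.QuantumLattice Literature.Probability.LatticeModels GrassmannAlgebra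
open Literature.MathematicalPhysics.QuantumLattice.FermiRG
open Literature.MathematicalPhysics.QuantumLattice.BandSectorCounting
open Summit.HubbardSuperconductivity.HubbardSuperconductivity.Theorems.KLRegimeSplit
open Summit.HubbardSuperconductivity.HubbardSuperconductivity.Theorems.KLProgrammeLegKernels
open Summit.HubbardSuperconductivity.HubbardSuperconductivity.Theorems.TorusFourierL2
open Summit.HubbardSuperconductivity.HubbardSuperconductivity.Theorems.DispersionFlow
open Summit.HubbardSuperconductivity.HubbardSuperconductivity.Theorems.KLRegimeWick

/-! ## §1 The anisotropic all-fixed line from the plain line, at any leg count -/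

/-- **ANISO ALL-FIXED LINE ≤ CA^{m+1} × PLAIN LINE AT ANY LEG COUNT** (absolute thresholds): `∃ CA > 0` (one constant for every `m`) such that, in the regime, for every
leg count `m + 1`, Grassmann element `G`, scale `1 ≤ n ≤ nScales β + 1`, label string `ω` and spin/charge strings `s, c`: if the PLAIN (trivial-family) `(m+1)`-leg
kernel of `G` has pinned `L¹` size `≤ S` at every pin, then `fixedTupleL1 β m (W^{F_n}_{m+1}(G)) ((ω i, s i), c i) x₁ ≤ CA^{m+1}·S`.  No smoothness of `Ĝ` on the sector
box is used (Young with the single-multiplier transfer sums `transferSums_klAniso_of_thresholds`, one parent string).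
[cite: BenfattoGiulianiMastropietro2006, §2.7 (2.71a), §2.8 (2.76)-(2.77)] -/
theorem fixedTupleL1_klAniso_le_of_plain_of_thresholds_legs (ha : (-4 : ℝ) < -(6 / 5)) (hab : (-(6 / 5) : ℝ) ≤ -(1 / 10)) (hb : (-(1 / 10) : ℝ) < 0) :
    ∃ CA : ℝ, 0 < CA ∧ ∀ (R : RenConsts), (∀ j, 0 ≤ R.Gfr j) →
      ∀ (c U : ℝ), 0 < c →
      c ≤ min (min ((bandBounds ha hab hb).Dtmin / 4) ((bandBounds ha hab hb).rhomin / 4)) (1 / 40) / (12 * (R.Gfr 2 + 1)) → 0 < U →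
      U ≤ min 1 (min (min ((bandBounds ha hab hb).Dtmin / 4) ((bandBounds ha hab hb).rhomin / 4)) (1 / 40) / (24 * (R.Gfr 0 + R.Gfr 1 + 1))) →
      ∀ β : ℝ, klBetaMin ≤ β → β ≤ Real.exp (c / U ^ 2) → ∀ μ ∈ klWindowC, ∀ K : TrigPolyC4v, FrameOK R U (nScales β) μ K →
      ∀ (L M : ℕ) [NeZero L] [NeZero M], β ^ 2 ≤ (L : ℝ) → β ≤ (M : ℝ) → ∀ n : ℕ, 1 ≤ n → n ≤ nScales β + 1 →
        ∀ (m : ℕ) (G : HubbardGrassmann L M) (ω : Fin (m + 1) → Fin (sectorCount n)) (s c' : Fin (m + 1) → Fin 2) (S : ℝ), 0 ≤ S →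
          (∀ y₀ : SpaceTimeIdx L M,
            fixedTupleL1 L M β m (sectorisedKernel L M β (trivialMultiplier L M) G (m + 1)) (fun i => (((0 : Fin 1), s i), c' i)) y₀ ≤ S) →
          ∀ x₁ : SpaceTimeIdx L M,
            fixedTupleL1 L M β m (sectorisedKernel L M β (klAnisoFamily L M β μ K klE0 n) G (m + 1)) (fun i => ((ω i, s i), c' i)) x₁ ≤
              CA ^ (m + 1) * S := by
  obtain ⟨CA, hCA, h⟩ := transferSums_klAniso_of_thresholds ha hab hb
  refine ⟨CA, hCA, ?_⟩
  intro R hR c U hc hcκ hU hUκ β hβmin hβc μ hμ K hK L M _ _ hL hM n hn hnN m G ω s c' S hS0 hS x₁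
  have hβ : 0 < β := KLRegimeSplit.pos_of_klBetaMin_le hβmin
  set F' := klAnisoFamily L M β μ K klE0 n with hF'
  set Ω' : Fin (m + 1) → SectorLeg (sectorCount n) := fun i => ((ω i, s i), c' i) with hΩ'
  -- plateau: the trivial family sums to one everywhere
  have hpl : ∀ (i : Fin (m + 1)) (k : FreqMomentum L M), F' (Ω' i).1.1 k ≠ 0 → ∑ w, trivialMultiplier L M w k = 1 := by
    intro i k _
    simp [trivialMultiplier]
  -- the single parent string
  have hParout : ∀ σ : Fin (m + 1) → Fin 1, σ ∉ (univ : Finset (Fin (m + 1) → Fin 1)) →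
      ∃ i, ∀ k, F' (Ω' i).1.1 k * trivialMultiplier L M (σ i) k = 0 :=
    fun σ hσ => absurd (mem_univ σ) hσ
  have hsum := fun i => h R hR c U hc hcκ hU hUκ β hβmin hβc μ hμ K hK L M hL hM n hn hnN (ω i) (s i) (c' i)
  have hSpar : ∀ σ ∈ (univ : Finset (Fin (m + 1) → Fin 1)), ∀ y₀ : SpaceTimeIdx L M,
      fixedTupleL1 L M β m (sectorisedKernel L M β (trivialMultiplier L M) G (m + 1)) (fun i => ((σ i, (Ω' i).1.2), (Ω' i).2)) y₀ ≤ S := by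
    intro σ _ y₀
    have hσ : σ = fun _ => 0 := funext fun i => Subsingleton.elim _ _
    subst hσ
    exact hS y₀
  have ht := fixedTupleL1_le_of_plateau_transfer hβ F' (trivialMultiplier L M) G Ω' hpl univ hParout hCA.le hS0
    (fun i y => (hsum i).1 y) (fun x => (hsum 0).2 x) hSpar x₁
  have hcard : ((univ : Finset (Fin (m + 1) → Fin 1)).card : ℝ) = 1 := by simp
  rw [hcard, one_mul] at ht
  exact ht

/-- **ANISO ALL-FIXED LINE ≤ CA^{m+1} × PLAIN LINE AT ANY LEG COUNT, UNDER EXACTLY THE BINDERS OF `stub_engine_step_norms`** (`P.WF`, `R.WF2`, `0 < c ≤ klEngC₃6 P R`,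
`μ ∈ klWindowC`, `0 < U ≤ klEngU₀9 P R c`, `klBetaMin ≤ β ≤ e^{c/U²}`, `FrameOK R U (nScales β) μ K`, `klEngL₃ β U ≤ L`, `klEngM₃ β U L ≤ M`; the package thresholds sit
below the absolute ones as in `fixedTupleL1_klAniso_le_of_plain_klEng`): `∃ CA > 0` (one constant for every `m`) with, for every `1 ≤ n ≤ nScales β + 1`, `m`, `G`,
strings and `S ≥ 0`: plain pinned `L¹ ≤ S` at every pin ⇒ `F_n`-sectorised all-fixed pinned `L¹ ≤ CA^{m+1}·S`.
[cite: BenfattoGiulianiMastropietro2006, §2.7 (2.71a), §2.8 (2.76)-(2.77)] -/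
theorem fixedTupleL1_klAniso_le_of_plain_klEng_legs :
    ∃ CA : ℝ, 0 < CA ∧ ∀ (P : SplitConsts) (R : RenConsts) (c : ℝ), P.WF → R.WF2 → 0 < c → c ≤ klEngC₃6 P R →
      ∀ μ ∈ klWindowC, ∀ U : ℝ, 0 < U → U ≤ klEngU₀9 P R c → ∀ β : ℝ, klBetaMin ≤ β → β ≤ Real.exp (c / U ^ 2) →
      ∀ K : TrigPolyC4v, FrameOK R U (nScales β) μ K → ∀ (L M : ℕ) [NeZero L] [NeZero M],
      klEngL₃ β U ≤ L → klEngM₃ β U L ≤ M → ∀ n : ℕ, 1 ≤ n → n ≤ nScales β + 1 →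
        ∀ (m : ℕ) (G : HubbardGrassmann L M) (ω : Fin (m + 1) → Fin (sectorCount n)) (s c' : Fin (m + 1) → Fin 2) (S : ℝ), 0 ≤ S →
          (∀ y₀ : SpaceTimeIdx L M,
            fixedTupleL1 L M β m (sectorisedKernel L M β (trivialMultiplier L M) G (m + 1)) (fun i => (((0 : Fin 1), s i), c' i)) y₀ ≤ S) →
          ∀ x₁ : SpaceTimeIdx L M,
            fixedTupleL1 L M β m (sectorisedKernel L M β (klAnisoFamily L M β μ K klE0 n) G (m + 1)) (fun i => ((ω i, s i), c' i)) x₁ ≤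
              CA ^ (m + 1) * S := by
  have ha : (-4 : ℝ) < -(6 / 5) := by norm_num
  have hab : (-(6 / 5) : ℝ) ≤ -(1 / 10) := by norm_num
  have hb : (-(1 / 10) : ℝ) < 0 := by norm_num
  obtain ⟨CA, hCA, h⟩ := fixedTupleL1_klAniso_le_of_plain_of_thresholds_legs ha hab hb
  refine ⟨CA, hCA, ?_⟩
  intro P R c _ hR2 hc hc6 μ hμ U hU hU9 β hβmin hβc K hK L M _ _ hL3 hM3 n hn hnN m G ω s c' S hS0 hS x₁
  have hRj : ∀ j, 0 ≤ R.Gfr j := gfr_nonneg_of_wf2 hR2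
  exact h R hRj c U hc
    (hc6.trans ((klEngC₃6_le_klEngC₃3 P R).trans (klEngC₃3_le_symbolC₃ ha hab hb P hRj))) hU
    (hU9.trans ((klEngU₀9_le_klEngU₀3 P R c).trans (klEngU₀3_le_symbolU₀ ha hab hb P hRj c)))
    β hβmin hβc μ hμ K hK L M (sq_le_of_klEngL₃_le hL3) (le_of_klEngM₃_le hβmin hL3 hM3) n hn hnN m G ω s c' S hS0 hS x₁

/-! ## §2 Any pinned leg, any pin, any leg count -/

variable {L M : ℕ} [NeZero L] [NeZero M]

/-- **Leg-`0` line ⇒ any-leg line at any leg count** for the sectorised `(m+1)`-leg kernel of `𝒱_j[K]`: if `fixedTupleL1 β m (W^F_{m+1}(𝒱_j[K])) Ω x₁ ≤ B` at every pin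
`x₁`, then for every leg `p` and pin `x`, `ε^m·Σ_{X : X p = x} ‖W^F_{m+1,Ω}(X)‖ ≤ B` (translation invariance of the conserving polynomial; `pinnedSum_le_of_fixedTupleL1_le`
is the instance `m = 3`). -/
theorem pinnedSum_le_of_fixedTupleL1_le_legs {N : ℕ} {β : ℝ} (hβ : β ≠ 0) (F : Fin N → FreqMomentum L M → ℂ) (U μ : ℝ) (K : TrigPolyC4v) (e₀ : ℝ) (j : ℕ)
    {m : ℕ} (Ω : Fin (m + 1) → SectorLeg N) {B : ℝ}
    (hB : ∀ x₁ : SpaceTimeIdx L M, fixedTupleL1 L M β m (sectorisedKernel L M β F (klEffectiveAction L M β U μ K e₀ j) (m + 1)) Ω x₁ ≤ B)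
    (p : Fin (m + 1)) (x : SpaceTimeIdx L M) :
    imagTimeWeight β M ^ m * ∑ X ∈ univ.filter (fun X : Fin (m + 1) → SpaceTimeIdx L M => X p = x),
      ‖sectorisedKernel L M β F (klEffectiveAction L M β U μ K e₀ j) (m + 1) Ω X‖ ≤ B := by
  rw [sum_filter_leg_eq_sum_pinned (fun X => ‖sectorisedKernel L M β F (klEffectiveAction L M β U μ K e₀ j) (m + 1) Ω X‖)
    (fun X a => norm_sectorisedKernel_klEffectiveAction_translate hβ F U μ K e₀ j (m + 1) Ω X a) p x x]
  exact hB x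

/-! ## §3 The composed six-leg consumer -/

/-- **IMPORT `X` (SIX LEGS, ONE LEVEL) IN FLOOR UNITS FROM THE PLAIN SIX-LEG LINE**: `∃ CA > 0` absolute such that, under the stub binders and the six-count doors, for every
block length `d`, block `k` with `1 ≤ dk − 1 ≤ nScales β + 1`, and `S₆ ≥ 0`: if for all spin/charge strings and every pin the plain six-leg kernel of `𝒱_{dk}[K]` has
`fixedTupleL1 β 5 … ≤ S₆`, then `klTowerMuLevAtF L M β U μ K d 0 k 3 ≤ 110592·klThinCount6C·(CA⁶·S₆)/ε⁵`.
[cite: BenfattoGiulianiMastropietro2006, §2.7 (2.71a), §2.8 (2.76)-(2.77), (2.96)-(2.98), Lemma 2.5] -/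
theorem klTowerMuLevAtF_zero_three_le_floor_import_of_plainLine_klEng :
    ∃ CA : ℝ, 0 < CA ∧ ∀ (P : SplitConsts) (R : RenConsts) (c : ℝ), P.WF → R.WF2 → 0 < c → c ≤ klEngC₃6 P R → c ≤ klThinCount6C₃ R →
      ∀ μ ∈ klWindowC, ∀ U : ℝ, 0 < U → U ≤ klEngU₀9 P R c → U ≤ klThinCount6U₀ R → ∀ β : ℝ, klBetaMin ≤ β → β ≤ Real.exp (c / U ^ 2) →
      ∀ K : TrigPolyC4v, FrameOK R U (nScales β) μ K → ∀ (L M : ℕ) [NeZero L] [NeZero M],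
      klEngL₃ β U ≤ L → klEngM₃ β U L ≤ M → ∀ d k : ℕ, 1 ≤ d * k - 1 → d * k - 1 ≤ nScales β + 1 →
        ∀ S₆ : ℝ, 0 ≤ S₆ →
          (∀ (s c' : Fin 6 → Fin 2) (y₀ : SpaceTimeIdx L M),
            fixedTupleL1 L M β 5 (sectorisedKernel L M β (trivialMultiplier L M) (klTowerInput L M β U μ K d k) 6)
              (fun i => (((0 : Fin 1), s i), c' i)) y₀ ≤ S₆) →
          klTowerMuLevAtF L M β U μ K d 0 k 3 ≤ 110592 * klThinCount6C * (CA ^ 6 * S₆) / imagTimeWeight β M ^ 5 := by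
  obtain ⟨CA, hCA, h⟩ := fixedTupleL1_klAniso_le_of_plain_klEng_legs
  refine ⟨CA, hCA, ?_⟩
  intro P R c hP hR2 hc hc6 hcT6 μ hμ U hU hU9 hUT6 β hβmin hβc K hK L M _ _ hL3 hM3 d k hn hnN S₆ hS0 hS
  have hRj : ∀ j, 0 ≤ R.Gfr j := gfr_nonneg_of_wf2 hR2
  have hβ0 : β ≠ 0 := (lt_of_lt_of_le (by norm_num [klBetaMin]) hβmin).ne'
  have hB : 0 ≤ CA ^ 6 * S₆ := mul_nonneg (pow_nonneg hCA.le 6) hS0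
  refine klTowerMuLevAtF_zero_three_le_floor_import_doors hRj hc hcT6 hU hUT6 hβmin hβc hμ μ hK d k hB ?_
  intro Ω _ p x
  -- the aniso all-fixed six-leg line at leg 0 from the plain line (§1 at `m = 5`), then any leg by translation invariance (§2)
  have hline0 : ∀ x₁ : SpaceTimeIdx L M,
      fixedTupleL1 L M β 5 (sectorisedKernel L M β (klAnisoFamily L M β μ K klE0 (d * k - 1)) (klTowerInput L M β U μ K d k) 6) Ω x₁ ≤
        CA ^ 6 * S₆ := by
    intro x₁
    have hΩ : Ω = fun i => (((Ω i).1.1, (Ω i).1.2), (Ω i).2) := funext fun i => by simp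
    rw [hΩ]
    exact h P R c hP hR2 hc hc6 μ hμ U hU hU9 β hβmin hβc K hK L M hL3 hM3 (d * k - 1) hn hnN 5 (klTowerInput L M β U μ K d k)
      (fun i => (Ω i).1.1) (fun i => (Ω i).1.2) (fun i => (Ω i).2) S₆ hS0 (hS _ _) x₁
  unfold klTowerInput at hline0 ⊢
  exact pinnedSum_le_of_fixedTupleL1_le_legs hβ0 _ U μ K klE0 (d * k) Ω hline0 p x

end Summit.HubbardSuperconductivity.HubbardSuperconductivity.Theorems.EngineV8

end
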